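import Literature.NumberTheory.Sieve.QuadraticRootsPrimeModuliDFIPoincare
import Literature.NumberTheory.Automorphic.BLZPeriodCocycleProofs
import HarnessLib

/-!
# The Laplacian of the strip kernel and the test profile of Proposition 4 (DFI 1995, support file)

Topic `Literature/NumberTheory/Sieve`.  Support file of the elementary proof of Proposition 4 of
W. Duke, J. B. Friedlander, H. Iwaniec, *Equidistribution of roots of a quadratic congruence to
prime moduli*, Ann. of Math. 141 (1995).  The Poincaré series (14) p. 428 is built on the kernel
`ψ(z) = Φ(Im z) e(η Re z)`; to control `ΔP_ψ = P_{Δψ}` (`QuadraticRootsPrimeModuliDFIPoincare`) we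
need `Δψ` explicitly, and for the specific profile of Proposition 4,
`Φ(y) = G(κ/y) e(c y)` with `G` supported in `[N, 2N]`, `|G^{(j)}| ≤ N^{-j}` (`j ≤ 2`), the size
of `Δψ`:

* `laplacian_comp_im`, `laplacian_comp_re` — `Δ_e (G ∘ Im) = G'' ∘ Im`, `Δ_e (E ∘ Re) = E'' ∘ Re`;
* `hypLaplacian_stripKernel` — **`Δψ = y² (Φ'' − 4π²η² Φ)(y) e(η x)`**, again a strip kernel;
* `iteratedDeriv_two_profile` — the second derivative of `y ↦ G(κ/y) e(c y)` on `y > 0`;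
* `norm_profile_le`, `profile_support`, `norm_laplaceProfile_le` — the profile is bounded by
  `sup |G|`, supported in `[κ/2N, κ/N]`, and, when `|c| ≤ c₀ h` and `h ≤ C₂ N`,
  `|y²(Φ'' − 4π²h²Φ)(y)| ≤ 8 + 4πκc₀C₂ + 4π²κ²c₀²C₂² + 4π²κ²C₂²` for all `y > 0`, uniformly in
  `N ≥ 1` (the hypothesis `h ≪ N` of Proposition 4).

Standard calculus; nothing of the paper is formalised here beyond the shape of its test function
(§4 p. 432: "put `G(n) = e(hb/an) F(2πh√D/an)`").

## References

* W. Duke, J. B. Friedlander, H. Iwaniec, Ann. of Math. (2) 141 (1995), 423–441, (14) p. 428 and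
  §4 p. 432. [cite: DukeFriedlanderIwaniec1995, (14) p. 428, §4 p. 432]
* H. Iwaniec, *Spectral Methods of Automorphic Forms*, GSM 53 (2002), (1.19)–(1.20) (the
  Laplacian in the coordinates `x, y`). [cite: Iwaniec2002, (1.19)–(1.20)]
-/

noncomputable section

namespace Literature.NumberTheory.Sieve

open _root_.MeasureTheory _root_.Set _root_.Filter _root_.UpperHalfPlane
open _root_.Literature.NumberTheory.Automorphic
open scoped Real Topology Laplacian

namespace DFI1995

/-! ### Laplacians of functions of `Im` and of `Re` -/

/-- `Δ_e (G ∘ Im)(z) = G''(Im z)` for `G ∈ C²(0, ∞)` and `Im z > 0`. [cite: Iwaniec2002, (1.20)] -/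
theorem laplacian_comp_im {G : ℝ → ℂ} {z : ℂ} (hG : ContDiffOn ℝ 2 G (Ioi 0)) (hz : 0 < z.im) :
    Δ (fun w : ℂ => G w.im) z = iteratedDeriv 2 G z.im := by
  set U : Set ℂ := {w : ℂ | 0 < w.im} with hU
  have hUo : IsOpen U := isOpen_upperHalfPlaneSet
  have hpre : (Complex.imCLM : ℂ →L[ℝ] ℝ) ⁻¹' Ioi 0 = U := by
    ext w; simp [hU]
  have hF : (fun w : ℂ => G w.im) = G ∘ (Complex.imCLM : ℂ →L[ℝ] ℝ) := by
    ext w; simp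
  rw [InnerProductSpace.laplacian_eq_iteratedFDeriv_complexPlane]
  simp only
  rw [hF, ← iteratedFDerivWithin_of_isOpen 2 hUo (show z ∈ U from hz), ← hpre,
    ContinuousLinearMap.iteratedFDerivWithin_comp_right _ hG (uniqueDiffOn_Ioi 0)
      (by rw [hpre]; exact hUo.uniqueDiffOn) (show Complex.imCLM z ∈ Ioi 0 from hz) le_rfl]
  simp only [ContinuousMultilinearMap.compContinuousLinearMap_apply,
    iteratedFDerivWithin_apply_eq_iteratedDerivWithin_mul_prod, Fin.prod_univ_two,
    Matrix.cons_val_zero, Matrix.cons_val_one, Complex.imCLM_apply,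
    Complex.one_im, Complex.I_im, mul_zero, zero_smul, zero_add, mul_one, one_smul]
  rw [iteratedDerivWithin_of_isOpen isOpen_Ioi (show z.im ∈ Ioi 0 from hz)]

/-- `Δ_e (E ∘ Re)(z) = E''(Re z)` for `E ∈ C²(ℝ)`. [cite: Iwaniec2002, (1.20)] -/
theorem laplacian_comp_re {E : ℝ → ℂ} (hE : ContDiff ℝ 2 E) (z : ℂ) :
    Δ (fun w : ℂ => E w.re) z = iteratedDeriv 2 E z.re := by
  have hF : (fun w : ℂ => E w.re) = E ∘ (Complex.reCLM : ℂ →L[ℝ] ℝ) := by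
    ext w; simp
  rw [InnerProductSpace.laplacian_eq_iteratedFDeriv_complexPlane]
  simp only
  rw [hF, ContinuousLinearMap.iteratedFDeriv_comp_right _ hE z le_rfl]
  simp only [ContinuousMultilinearMap.compContinuousLinearMap_apply,
    iteratedFDeriv_apply_eq_iteratedDeriv_mul_prod, Fin.prod_univ_two,
    Matrix.cons_val_zero, Matrix.cons_val_one, Complex.reCLM_apply,
    Complex.one_re, Complex.I_re, mul_zero, mul_one, one_smul, zero_smul, add_zero]

/-- `∂ₓ (G ∘ Im) = 0`. [folklore] -/
theorem fderiv_comp_im_apply_one {G : ℝ → ℂ} {z : ℂ} (hG : DifferentiableAt ℝ G z.im) :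
    fderiv ℝ (fun w : ℂ => G w.im) z 1 = 0 := by
  have hF : (fun w : ℂ => G w.im) = G ∘ (Complex.imCLM : ℂ →L[ℝ] ℝ) := by
    ext w; simp
  rw [hF, fderiv_comp z (by simpa using hG) Complex.imCLM.differentiableAt, ContinuousLinearMap.fderiv]
  simp

/-- `∂ᵧ (E ∘ Re) = 0`. [folklore] -/
theorem fderiv_comp_re_apply_I {E : ℝ → ℂ} {z : ℂ} (hE : DifferentiableAt ℝ E z.re) :
    fderiv ℝ (fun w : ℂ => E w.re) z Complex.I = 0 := by
  have hF : (fun w : ℂ => E w.re) = E ∘ (Complex.reCLM : ℂ →L[ℝ] ℝ) := by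
    ext w; simp
  rw [hF, fderiv_comp z (by simpa using hE) Complex.reCLM.differentiableAt, ContinuousLinearMap.fderiv]
  simp

/-! ### The Laplacian of the strip kernel -/

/-- The oscillating factor `E(t) = e(ηt)` and its derivative `E' = 2πiη E`. [folklore] -/
theorem hasDerivAt_exp_two_pi (η : ℝ) (t : ℝ) :
    HasDerivAt (fun t : ℝ => Complex.exp (2 * π * Complex.I * η * (t : ℂ)))
      (Complex.exp (2 * π * Complex.I * η * (t : ℂ)) * (2 * π * Complex.I * η)) t := by
  have h1 : HasDerivAt (fun t : ℝ => 2 * π * Complex.I * η * (t : ℂ)) (2 * π * Complex.I * η * 1) t :=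
    (hasDerivAt_id t).ofReal_comp.const_mul _
  rw [mul_one] at h1
  exact h1.cexp

/-- `E ∈ C^∞`. [folklore] -/
theorem contDiff_exp_two_pi (η : ℝ) {n : WithTop ℕ∞} :
    ContDiff ℝ n (fun t : ℝ => Complex.exp (2 * π * Complex.I * η * (t : ℂ))) :=
  Complex.contDiff_exp.comp (contDiff_const.mul Complex.ofRealCLM.contDiff)

/-- `E'' = −4π²η² E`. [folklore] -/
theorem iteratedDeriv_two_exp_two_pi (η : ℝ) (t : ℝ) :
    iteratedDeriv 2 (fun t : ℝ => Complex.exp (2 * π * Complex.I * η * (t : ℂ))) t =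
      -(4 * π ^ 2 * η ^ 2 : ℝ) * Complex.exp (2 * π * Complex.I * η * (t : ℂ)) := by
  rw [iteratedDeriv_succ, iteratedDeriv_one]
  have hd : deriv (fun t : ℝ => Complex.exp (2 * π * Complex.I * η * (t : ℂ))) =
      fun t : ℝ => Complex.exp (2 * π * Complex.I * η * (t : ℂ)) * (2 * π * Complex.I * η) :=
    funext fun t => (hasDerivAt_exp_two_pi η t).deriv
  rw [hd, ((hasDerivAt_exp_two_pi η t).mul_const (2 * π * Complex.I * η)).deriv]
  have hI : Complex.I * Complex.I = -1 := Complex.I_mul_I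
  push_cast
  linear_combination (4 * (π : ℂ) ^ 2 * η ^ 2 * Complex.exp (2 * π * Complex.I * η * (t : ℂ))) * hI

/-- **The Laplacian of the strip kernel**: for `Φ ∈ C²(0, ∞)`,
`Δ(Φ(Im ·) e(η Re ·))(z) = (Im z)² (Φ''(Im z) − 4π²η² Φ(Im z)) e(η Re z)` — again a strip kernel,
with profile `y²(Φ'' − 4π²η²Φ)`. [cite: Iwaniec2002, (1.20)] -/
theorem hypLaplacian_stripKernel {Φ : ℝ → ℂ} (hΦ : ContDiffOn ℝ 2 Φ (Ioi 0)) (η : ℤ) (z : ℍ) :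
    hypLaplacian (fun w : ℍ => Φ w.im * Complex.exp (2 * π * Complex.I * η * (w.re : ℂ))) z =
      ((z.im : ℝ) : ℂ) ^ 2 * (iteratedDeriv 2 Φ z.im - (4 * π ^ 2 * (η : ℝ) ^ 2 : ℝ) * Φ z.im) *
        Complex.exp (2 * π * Complex.I * η * (z.re : ℂ)) := by
  set E : ℝ → ℂ := fun t => Complex.exp (2 * π * Complex.I * (η : ℝ) * (t : ℂ)) with hE
  have hEc : ContDiff ℝ 2 E := contDiff_exp_two_pi (η : ℝ)
  unfold hypLaplacian
  have heq : ((fun w : ℍ => Φ w.im * Complex.exp (2 * π * Complex.I * η * (w.re : ℂ))) ∘ ofComplex) =ᶠ[𝓝 (z : ℂ)]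
      ((fun w : ℂ => Φ w.im) * fun w : ℂ => E w.re) := by
    filter_upwards [isOpen_upperHalfPlaneSet.mem_nhds z.im_pos] with w hw
    rw [stripKernel_comp_ofComplex_eqOn Φ η hw, Pi.mul_apply, hE]
    push_cast
    rfl
  rw [(InnerProductSpace.laplacian_congr_nhds heq).self_of_nhds]
  have hΦat : ContDiffAt ℝ 2 Φ z.im := hΦ.contDiffAt (isOpen_Ioi.mem_nhds z.im_pos)
  have hf : ContDiffAt ℝ 2 (fun w : ℂ => Φ w.im) (z : ℂ) := by
    have : (fun w : ℂ => Φ w.im) = Φ ∘ (Complex.imCLM : ℂ →L[ℝ] ℝ) := by ext w; simp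
    rw [this]
    exact hΦat.comp (z : ℂ) Complex.imCLM.contDiff.contDiffAt
  have hg : ContDiffAt ℝ 2 (fun w : ℂ => E w.re) (z : ℂ) := by
    have : (fun w : ℂ => E w.re) = E ∘ (Complex.reCLM : ℂ →L[ℝ] ℝ) := by ext w; simp
    rw [this]
    exact hEc.contDiffAt.comp (z : ℂ) Complex.reCLM.contDiff.contDiffAt
  rw [laplacian_mul hf hg, laplacian_comp_im hΦ z.im_pos, laplacian_comp_re hEc,
    fderiv_comp_im_apply_one (hΦat.differentiableAt (by norm_num)),
    fderiv_comp_re_apply_I (hEc.contDiffAt.differentiableAt (by norm_num)), hE,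
    iteratedDeriv_two_exp_two_pi]
  simp only [UpperHalfPlane.coe_im, UpperHalfPlane.coe_re]
  push_cast
  ring

/-! ### The test profile `Φ(y) = G(κ/y) e(c y)` -/

section profile

variable {G : ℝ → ℂ} {N κ c : ℝ}

/-- The map `y ↦ κ/y` has derivative `−κ/y²` at `y ≠ 0`. [folklore] -/
theorem hasDerivAt_const_div {κ y : ℝ} (hy : y ≠ 0) :
    HasDerivAt (fun y : ℝ => κ / y) (-(κ / y ^ 2)) y := by
  have h := (hasDerivAt_inv hy).const_mul κ
  have e : κ * -(y ^ 2)⁻¹ = -(κ / y ^ 2) := by ring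
  rw [e] at h
  exact h.congr_of_eventuallyEq (Eventually.of_forall fun u => by simp [div_eq_mul_inv])

/-- **First derivative of the profile** on `y > 0`:
`(G(κ/y) E(y))' = −(κ/y²) G'(κ/y) E(y) + G(κ/y) E'(y)`. [folklore] -/
theorem hasDerivAt_profile (hG : Differentiable ℝ G) (κ c : ℝ) {y : ℝ} (hy : 0 < y) :
    HasDerivAt (fun y : ℝ => G (κ / y) * Complex.exp (2 * π * Complex.I * c * (y : ℂ)))
      ((-(κ / y ^ 2) : ℝ) • deriv G (κ / y) * Complex.exp (2 * π * Complex.I * c * (y : ℂ)) +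
        G (κ / y) * (Complex.exp (2 * π * Complex.I * c * (y : ℂ)) * (2 * π * Complex.I * c))) y := by
  have h1 : HasDerivAt (fun y : ℝ => G (κ / y)) ((-(κ / y ^ 2) : ℝ) • deriv G (κ / y)) y :=
    HasDerivAt.scomp y (hG (κ / y)).hasDerivAt (hasDerivAt_const_div hy.ne')
  exact h1.mul (hasDerivAt_exp_two_pi c y)

/-- The derivative of the profile as a function on `(0, ∞)`. [folklore] -/
theorem deriv_profile_eqOn (hG : Differentiable ℝ G) (κ c : ℝ) :
    EqOn (deriv fun y : ℝ => G (κ / y) * Complex.exp (2 * π * Complex.I * c * (y : ℂ)))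
      (fun y => (-(κ / y ^ 2) : ℝ) • deriv G (κ / y) * Complex.exp (2 * π * Complex.I * c * (y : ℂ)) +
        G (κ / y) * (Complex.exp (2 * π * Complex.I * c * (y : ℂ)) * (2 * π * Complex.I * c)))
      (Ioi 0) :=
  fun _ hy => (hasDerivAt_profile hG κ c hy).deriv

/-- **Second derivative of the profile** on `y > 0`:
`(G(κ/y)E)'' = (2κ/y³ G'(κ/y) + κ²/y⁴ G''(κ/y)) E − 2(κ/y²) G'(κ/y) E' + G(κ/y) E''`,
`E' = 2πic E`, `E'' = −4π²c² E`. [folklore] -/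
theorem iteratedDeriv_two_profile (hG : ContDiff ℝ 2 G) (κ c : ℝ) {y : ℝ} (hy : 0 < y) :
    iteratedDeriv 2 (fun y : ℝ => G (κ / y) * Complex.exp (2 * π * Complex.I * c * (y : ℂ))) y =
      (((2 * κ / y ^ 3 : ℝ) : ℂ) * deriv G (κ / y) + ((κ ^ 2 / y ^ 4 : ℝ) : ℂ) * deriv (deriv G) (κ / y)
        - 2 * ((κ / y ^ 2 : ℝ) : ℂ) * deriv G (κ / y) * (2 * π * Complex.I * c)
        + G (κ / y) * (2 * π * Complex.I * c) ^ 2) *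
        Complex.exp (2 * π * Complex.I * c * (y : ℂ)) := by
  have hGd : Differentiable ℝ G := hG.differentiable (by norm_num)
  have hG'd : Differentiable ℝ (deriv G) := by
    have := hG.differentiable_iteratedDeriv 1 (by norm_num)
    rwa [iteratedDeriv_one] at this
  rw [iteratedDeriv_succ, iteratedDeriv_one]
  -- replace `deriv Φ` by its closed form near `y`
  have hev : deriv (fun y : ℝ => G (κ / y) * Complex.exp (2 * π * Complex.I * c * (y : ℂ))) =ᶠ[𝓝 y]
      fun y => (-(κ / y ^ 2) : ℝ) • deriv G (κ / y) * Complex.exp (2 * π * Complex.I * c * (y : ℂ)) +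
        G (κ / y) * (Complex.exp (2 * π * Complex.I * c * (y : ℂ)) * (2 * π * Complex.I * c)) := by
    filter_upwards [isOpen_Ioi.mem_nhds hy] with u hu
    exact deriv_profile_eqOn hGd κ c hu
  rw [hev.deriv_eq]
  -- differentiate the closed form
  set E : ℝ → ℂ := fun t => Complex.exp (2 * π * Complex.I * c * (t : ℂ)) with hE
  have hEd : ∀ t, HasDerivAt E (E t * (2 * π * Complex.I * c)) t := hasDerivAt_exp_two_pi c
  -- `y ↦ -(κ/y²)` as `-κ * y⁻¹ * y⁻¹`
  have hy0 : y ≠ 0 := hy.ne'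
  have hA : HasDerivAt (fun y : ℝ => (-(κ / y ^ 2) : ℝ)) (2 * κ / y ^ 3) y := by
    have h1 : HasDerivAt (fun y : ℝ => y ^ 2) (2 * y) y := by simpa using hasDerivAt_pow 2 y
    have h2 := (hasDerivAt_const y (-κ)).div h1 (pow_ne_zero 2 hy0)
    refine (h2.congr_of_eventuallyEq (Eventually.of_forall fun u => ?_)).congr_deriv ?_
    · simp only [Pi.div_apply]; ring
    · field_simp; ring
  have hB : HasDerivAt (fun y : ℝ => deriv G (κ / y)) ((-(κ / y ^ 2) : ℝ) • deriv (deriv G) (κ / y)) y :=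
    HasDerivAt.scomp y (hG'd (κ / y)).hasDerivAt (hasDerivAt_const_div hy.ne')
  have hC : HasDerivAt (fun y : ℝ => G (κ / y)) ((-(κ / y ^ 2) : ℝ) • deriv G (κ / y)) y :=
    HasDerivAt.scomp y (hGd (κ / y)).hasDerivAt (hasDerivAt_const_div hy.ne')
  have hAB := hA.smul hB
  have h1 := (hAB.mul (hEd y)).add (hC.mul ((hEd y).mul_const (2 * π * Complex.I * c)))
  have h1' : HasDerivAt (fun y : ℝ => (-(κ / y ^ 2) : ℝ) • deriv G (κ / y) * E y +
      G (κ / y) * (E y * (2 * π * Complex.I * c))) _ y := h1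
  have hfun : (fun y : ℝ => (-(κ / y ^ 2) : ℝ) • deriv G (κ / y) * Complex.exp (2 * π * Complex.I * c * (y : ℂ)) +
      G (κ / y) * (Complex.exp (2 * π * Complex.I * c * (y : ℂ)) * (2 * π * Complex.I * c))) =
      fun y : ℝ => (-(κ / y ^ 2) : ℝ) • deriv G (κ / y) * E y + G (κ / y) * (E y * (2 * π * Complex.I * c)) := by
    rfl
  rw [hfun, h1'.deriv]
  simp only [hE, Complex.real_smul, Pi.smul_apply']
  have hy' : (y : ℂ) ≠ 0 := by exact_mod_cast hy0
  set t : ℝ := κ / y with ht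
  push_cast
  field_simp
  ring

/-- The profile vanishes near every `y ≤ 0` and wherever `κ/y ∉ [N, 2N]`; precisely, if
`G(t) ≠ 0 ⇒ N ≤ t ≤ 2N` with `N > 0`, `κ > 0`, then `G(κ/y) ≠ 0 ⇒ κ/(2N) ≤ y ≤ κ/N`. [folklore] -/
theorem profile_support (hN : 0 < N) (hκ : 0 < κ) (hG0 : ∀ t, G t ≠ 0 → N ≤ t ∧ t ≤ 2 * N)
    {y : ℝ} (hy : G (κ / y) * Complex.exp (2 * π * Complex.I * c * (y : ℂ)) ≠ 0) :
    κ / (2 * N) ≤ y ∧ y ≤ κ / N := by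
  have hG : G (κ / y) ≠ 0 := fun h => hy (by rw [h, zero_mul])
  obtain ⟨h1, h2⟩ := hG0 _ hG
  have hy0 : 0 < y := by
    by_contra h
    have h' : y ≤ 0 := le_of_not_gt h
    have : κ / y ≤ 0 := div_nonpos_of_nonneg_of_nonpos hκ.le h'
    linarith
  rw [le_div_iff₀ hy0] at h1
  rw [div_le_iff₀ hy0] at h2
  constructor
  · rw [div_le_iff₀ (by positivity)]; linarith
  · rw [le_div_iff₀ hN]; linarith

/-- `|Φ(y)| ≤ sup |G|`. [folklore] -/
theorem norm_profile_le {B : ℝ} (hGB : ∀ t, ‖G t‖ ≤ B) (y : ℝ) :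
    ‖G (κ / y) * Complex.exp (2 * π * Complex.I * c * (y : ℂ))‖ ≤ B := by
  rw [norm_mul]
  have : ‖Complex.exp (2 * π * Complex.I * c * (y : ℂ))‖ = 1 := by
    rw [show 2 * π * Complex.I * c * (y : ℂ) = ((2 * π * c * y : ℝ) : ℂ) * Complex.I by push_cast; ring]
    exact Complex.norm_exp_ofReal_mul_I _
  rw [this, mul_one]
  exact hGB _

/-- Derivatives of `G` vanish off `[N, 2N]` when `G` does. [folklore] -/
theorem deriv_support_of_support (hG0 : ∀ t, G t ≠ 0 → N ≤ t ∧ t ≤ 2 * N) :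
    (∀ t, deriv G t ≠ 0 → N ≤ t ∧ t ≤ 2 * N) ∧ (∀ t, deriv (deriv G) t ≠ 0 → N ≤ t ∧ t ≤ 2 * N) := by
  have hts : tsupport G ⊆ Icc N (2 * N) :=
    closure_minimal (fun t ht => hG0 t ht) isClosed_Icc
  have h1 : ∀ t, deriv G t ≠ 0 → N ≤ t ∧ t ≤ 2 * N := fun t ht =>
    hts (support_deriv_subset (Function.mem_support.2 ht))
  refine ⟨h1, fun t ht => ?_⟩
  exact hts (tsupport_deriv_subset (support_deriv_subset (Function.mem_support.2 ht)))

/-- **The size of the Laplace profile.**  Let `G ∈ C²` with `G(t) ≠ 0 ⇒ N ≤ t ≤ 2N`,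
`|G| ≤ 1`, `|G'| ≤ N⁻¹`, `|G''| ≤ N⁻²`, `N ≥ 1`, `κ > 0`, and `|c| ≤ c₀ h` with `h ≤ C₂ N`.  Then for
`Φ(y) = G(κ/y) e(c y)` and every `y > 0`,
`|y² (Φ''(y) − 4π²h² Φ(y))| ≤ 8 + 4πκ c₀ C₂ + 4π²κ² c₀² C₂² + 4π²κ² C₂²`.
[cite: DukeFriedlanderIwaniec1995, §4 p. 432 (the test function of Prop. 4)] -/
theorem norm_laplaceProfile_le (hG : ContDiff ℝ 2 G) (hN : 1 ≤ N) (hκ : 0 < κ)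
    (hG0 : ∀ t, G t ≠ 0 → N ≤ t ∧ t ≤ 2 * N) (hGb : ∀ t, ‖G t‖ ≤ 1)
    (hG1 : ∀ t, ‖deriv G t‖ ≤ N⁻¹) (hG2 : ∀ t, ‖deriv (deriv G) t‖ ≤ (N ^ 2)⁻¹)
    {h C₂ c₀ : ℝ} (hh0 : 0 ≤ h) (hC₂ : h ≤ C₂ * N) (hc₀ : 0 ≤ c₀) (hc : |c| ≤ c₀ * h) {y : ℝ} (hy : 0 < y) :
    ‖((y : ℝ) : ℂ) ^ 2 * (iteratedDeriv 2 (fun y : ℝ => G (κ / y) * Complex.exp (2 * π * Complex.I * c * (y : ℂ))) y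
        - (4 * π ^ 2 * h ^ 2 : ℝ) * (G (κ / y) * Complex.exp (2 * π * Complex.I * c * (y : ℂ))))‖ ≤
      8 + 4 * π * κ * c₀ * C₂ + 4 * π ^ 2 * κ ^ 2 * c₀ ^ 2 * C₂ ^ 2 + 4 * π ^ 2 * κ ^ 2 * C₂ ^ 2 := by
  have hN0 : 0 < N := by linarith
  obtain ⟨hd1, hd2⟩ := deriv_support_of_support hG0
  set t : ℝ := κ / y with ht
  have ht0 : 0 < t := div_pos hκ hy
  have hyt : y = κ / t := by rw [ht]; field_simp
  set E : ℂ := Complex.exp (2 * π * Complex.I * c * (y : ℂ)) with hE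
  have hE1 : ‖E‖ = 1 := by
    rw [hE, show 2 * π * Complex.I * c * (y : ℂ) = ((2 * π * c * y : ℝ) : ℂ) * Complex.I by push_cast; ring]
    exact Complex.norm_exp_ofReal_mul_I _
  rw [iteratedDeriv_two_profile hG κ c hy]
  -- the four terms
  have hC₂0 : 0 ≤ C₂ * N := hh0.trans hC₂
  have hC₂0' : 0 ≤ C₂ := nonneg_of_mul_nonneg_left hC₂0 hN0 |> fun h => by nlinarith
  have hhN : h / N ≤ C₂ := by rw [div_le_iff₀ hN0]; exact hC₂
  -- (1) `y² · (2κ/y³ G' + κ²/y⁴ G'')` has norm `≤ 2t|G'(t)| + t²|G''(t)| ≤ 8`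
  have hT1 : ‖((y : ℝ) : ℂ) ^ 2 * (((2 * κ / y ^ 3 : ℝ) : ℂ) * deriv G (κ / y) +
      ((κ ^ 2 / y ^ 4 : ℝ) : ℂ) * deriv (deriv G) (κ / y))‖ ≤ 8 := by
    have e1 : ((y : ℝ) : ℂ) ^ 2 * (((2 * κ / y ^ 3 : ℝ) : ℂ) * deriv G (κ / y) +
        ((κ ^ 2 / y ^ 4 : ℝ) : ℂ) * deriv (deriv G) (κ / y)) =
        ((2 * t : ℝ) : ℂ) * deriv G t + ((t ^ 2 : ℝ) : ℂ) * deriv (deriv G) t := by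
      have hy' : (y : ℂ) ≠ 0 := by exact_mod_cast hy.ne'
      simp only [ht]
      push_cast
      field_simp
    rw [e1]
    have hα : ‖((2 * t : ℝ) : ℂ) * deriv G t‖ ≤ 4 := by
      rw [norm_mul, Complex.norm_real, Real.norm_of_nonneg (by positivity)]
      by_cases h0 : deriv G t = 0
      · rw [h0, norm_zero, mul_zero]; norm_num
      · obtain ⟨-, ht2⟩ := hd1 t h0
        calc 2 * t * ‖deriv G t‖ ≤ 2 * (2 * N) * N⁻¹ :=
              mul_le_mul (by linarith) (hG1 t) (norm_nonneg _) (by positivity)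
          _ = 4 := by field_simp; ring
    have hβ : ‖((t ^ 2 : ℝ) : ℂ) * deriv (deriv G) t‖ ≤ 4 := by
      rw [norm_mul, Complex.norm_real, Real.norm_of_nonneg (by positivity)]
      by_cases h0 : deriv (deriv G) t = 0
      · rw [h0, norm_zero, mul_zero]; norm_num
      · obtain ⟨-, ht2⟩ := hd2 t h0
        calc t ^ 2 * ‖deriv (deriv G) t‖ ≤ (2 * N) ^ 2 * (N ^ 2)⁻¹ :=
              mul_le_mul (pow_le_pow_left₀ ht0.le ht2 2) (hG2 t) (norm_nonneg _) (by positivity)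
          _ = 4 := by field_simp; ring
    exact (norm_add_le _ _).trans (by linarith)
  -- (2) the cross term `2 (κ/y²) G'(t) (2πic) · y² = 4πic κ G'(t)`
  have hT2 : ‖((y : ℝ) : ℂ) ^ 2 * (2 * ((κ / y ^ 2 : ℝ) : ℂ) * deriv G (κ / y) * (2 * π * Complex.I * c))‖ ≤
      4 * π * κ * c₀ * C₂ := by
    have e1 : ((y : ℝ) : ℂ) ^ 2 * (2 * ((κ / y ^ 2 : ℝ) : ℂ) * deriv G (κ / y) * (2 * π * Complex.I * c)) =
        ((4 * π * κ * c : ℝ) : ℂ) * Complex.I * deriv G t := by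
      have hy' : (y : ℂ) ≠ 0 := by exact_mod_cast hy.ne'
      simp only [ht]
      push_cast
      field_simp
      ring
    rw [e1, norm_mul, norm_mul, Complex.norm_I, mul_one, Complex.norm_real, Real.norm_eq_abs]
    have h1 : |4 * π * κ * c| ≤ 4 * π * κ * (c₀ * h) := by
      rw [abs_mul, abs_of_pos (by positivity : (0 : ℝ) < 4 * π * κ)]
      exact mul_le_mul_of_nonneg_left hc (by positivity)
    calc |4 * π * κ * c| * ‖deriv G t‖ ≤ 4 * π * κ * (c₀ * h) * N⁻¹ :=
          mul_le_mul h1 (hG1 t) (norm_nonneg _) (by positivity)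
      _ = 4 * π * κ * c₀ * (h / N) := by ring
      _ ≤ 4 * π * κ * c₀ * C₂ := mul_le_mul_of_nonneg_left hhN (by positivity)
  -- (3) `y² G(t) (2πic)² = −4π²c² y² G(t)`, `y ≤ κ/N` when `G(t) ≠ 0`
  have hT3 : ‖((y : ℝ) : ℂ) ^ 2 * (G (κ / y) * (2 * π * Complex.I * c) ^ 2)‖ ≤
      4 * π ^ 2 * κ ^ 2 * c₀ ^ 2 * C₂ ^ 2 := by
    by_cases h0 : G (κ / y) = 0
    · rw [h0, zero_mul, mul_zero, norm_zero]; positivity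
    · obtain ⟨ht1, -⟩ := hG0 _ h0
      have hyle : y ≤ κ / N := by rw [hyt]; exact div_le_div_of_nonneg_left hκ.le hN0 ht1
      have e1 : ((y : ℝ) : ℂ) ^ 2 * (G (κ / y) * (2 * π * Complex.I * c) ^ 2) =
          -(((4 * π ^ 2 * c ^ 2 * y ^ 2 : ℝ) : ℂ) * G (κ / y)) := by
        push_cast
        have hI : Complex.I ^ 2 = -1 := Complex.I_sq
        linear_combination ((4 : ℂ) * π ^ 2 * c ^ 2 * y ^ 2 * G (κ / y)) * hI
      rw [e1, norm_neg, norm_mul, Complex.norm_real, Real.norm_of_nonneg (by positivity)]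
      have hc2 : c ^ 2 ≤ (c₀ * h) ^ 2 := by
        rw [← sq_abs c]; exact pow_le_pow_left₀ (abs_nonneg c) hc 2
      have hy2 : y ^ 2 ≤ (κ / N) ^ 2 := pow_le_pow_left₀ hy.le hyle 2
      have hhN2 : (h / N) ^ 2 ≤ C₂ ^ 2 := pow_le_pow_left₀ (by positivity) hhN 2
      have hG1' : ‖G (κ / y)‖ ≤ 1 := hGb _
      calc 4 * π ^ 2 * c ^ 2 * y ^ 2 * ‖G (κ / y)‖ ≤ 4 * π ^ 2 * (c₀ * h) ^ 2 * (κ / N) ^ 2 * 1 := by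
            gcongr
        _ = 4 * π ^ 2 * κ ^ 2 * c₀ ^ 2 * (h / N) ^ 2 := by field_simp
        _ ≤ 4 * π ^ 2 * κ ^ 2 * c₀ ^ 2 * C₂ ^ 2 := by gcongr
  -- (4) `4π²h² y² Φ(y)`
  have hT4 : ‖(4 * π ^ 2 * h ^ 2 : ℝ) * (((y : ℝ) : ℂ) ^ 2 * (G (κ / y) * E))‖ ≤ 4 * π ^ 2 * κ ^ 2 * C₂ ^ 2 := by
    by_cases h0 : G (κ / y) = 0
    · rw [h0, zero_mul, mul_zero, mul_zero, norm_zero]; positivity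
    · obtain ⟨ht1, -⟩ := hG0 _ h0
      have hyle : y ≤ κ / N := by rw [hyt]; exact div_le_div_of_nonneg_left hκ.le hN0 ht1
      have hy2 : y ^ 2 ≤ (κ / N) ^ 2 := pow_le_pow_left₀ hy.le hyle 2
      have hhN2 : (h / N) ^ 2 ≤ C₂ ^ 2 := pow_le_pow_left₀ (by positivity) hhN 2
      rw [norm_mul, norm_mul, norm_mul, hE1, mul_one, Complex.norm_real, Real.norm_of_nonneg (by positivity),
        norm_pow, Complex.norm_real, Real.norm_of_nonneg hy.le]
      calc 4 * π ^ 2 * h ^ 2 * (y ^ 2 * ‖G (κ / y)‖) ≤ 4 * π ^ 2 * h ^ 2 * ((κ / N) ^ 2 * 1) := by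
            gcongr
            exact hGb _
        _ = 4 * π ^ 2 * κ ^ 2 * (h / N) ^ 2 := by field_simp
        _ ≤ 4 * π ^ 2 * κ ^ 2 * C₂ ^ 2 := by gcongr
  -- assemble
  rw [← hE]
  have e : ((y : ℝ) : ℂ) ^ 2 * ((((2 * κ / y ^ 3 : ℝ) : ℂ) * deriv G (κ / y) +
      ((κ ^ 2 / y ^ 4 : ℝ) : ℂ) * deriv (deriv G) (κ / y)
        - 2 * ((κ / y ^ 2 : ℝ) : ℂ) * deriv G (κ / y) * (2 * π * Complex.I * c)
        + G (κ / y) * (2 * π * Complex.I * c) ^ 2) * E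
      - (4 * π ^ 2 * h ^ 2 : ℝ) * (G (κ / y) * E)) =
      (((y : ℝ) : ℂ) ^ 2 * (((2 * κ / y ^ 3 : ℝ) : ℂ) * deriv G (κ / y) +
          ((κ ^ 2 / y ^ 4 : ℝ) : ℂ) * deriv (deriv G) (κ / y))
        - ((y : ℝ) : ℂ) ^ 2 * (2 * ((κ / y ^ 2 : ℝ) : ℂ) * deriv G (κ / y) * (2 * π * Complex.I * c))
        + ((y : ℝ) : ℂ) ^ 2 * (G (κ / y) * (2 * π * Complex.I * c) ^ 2)) * E
        - (4 * π ^ 2 * h ^ 2 : ℝ) * (((y : ℝ) : ℂ) ^ 2 * (G (κ / y) * E)) := by ring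
  rw [e]
  refine (norm_sub_le _ _).trans ?_
  rw [norm_mul, hE1, mul_one]
  have h3 := norm_add_le
    (((y : ℝ) : ℂ) ^ 2 * (((2 * κ / y ^ 3 : ℝ) : ℂ) * deriv G (κ / y) +
        ((κ ^ 2 / y ^ 4 : ℝ) : ℂ) * deriv (deriv G) (κ / y))
      - ((y : ℝ) : ℂ) ^ 2 * (2 * ((κ / y ^ 2 : ℝ) : ℂ) * deriv G (κ / y) * (2 * π * Complex.I * c)))
    (((y : ℝ) : ℂ) ^ 2 * (G (κ / y) * (2 * π * Complex.I * c) ^ 2))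
  have h4 := norm_sub_le
    (((y : ℝ) : ℂ) ^ 2 * (((2 * κ / y ^ 3 : ℝ) : ℂ) * deriv G (κ / y) +
        ((κ ^ 2 / y ^ 4 : ℝ) : ℂ) * deriv (deriv G) (κ / y)))
    (((y : ℝ) : ℂ) ^ 2 * (2 * ((κ / y ^ 2 : ℝ) : ℂ) * deriv G (κ / y) * (2 * π * Complex.I * c)))
  linarith [hT1, hT2, hT3, hT4, h3, h4]

end profile

end DFI1995

end Literature.NumberTheory.Sieve
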